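import Summits.KontsevichZagierPeriods.KontsevichZagierPeriods.Theorems.StandardPartsSpArcClosureOfSummit
import Literature.NumberTheory.Transcendental.KZTameMoveFamily
import Literature.NumberTheory.Transcendental.KZBallPeelingAux

/-!
# Route StandardParts — `SpArcLifting` (stmt-KontsevichZagierPeriods-3155): the raw-arc frame

Problem `KontsevichZagierPeriods`, route `StandardParts`, crux item stmt-KontsevichZagierPeriods-3155
(`SpArcLifting`). Helper file (`--supports`) of the line `registered` (`Cruxes/SpArcLifting/Lines/birth.lean`):
the sorry-free FRAME of the line, i.e. everything of the skeleton except its two stubs, plus the two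
converses which certify that the stubs are summit-implied.

The route's thesis is `X = SpArcClosure ∧ SpArcLifting` (`closes : SpArcClosure → SpArcLifting →
KontsevichZagierPeriods` in the route file). As typed — arcs `R : ℝ → KZ.IntegralRep n` with
`ℚ`-semialgebraic total data — both halves collapse (three refuter reviews on items 3153/3155 and the
design notes of `Literature/NumberTheory/Transcendental/KZMoveFamily.lean`): every fibre `R t` is
`ℚ`-semialgebraic, so the arc is eventually constant at `0⁺` (arc rigidity, the stub of the parallel
line on item 3153), hence `SpArcClosure` is provable outright and `SpArcLifting` is the summit. The line
therefore re-types the two halves over RAW `ℚ`-semialgebraic one-parameter families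
(`KZ.RawFamily`, `Literature/NumberTheory/Transcendental/KZTameMoveFamily.lean`): ONE `ℚ`-semialgebraic
total domain and integrand, fibres `S.fibre t`, `S.fibreFun t` plain sets / functions
(`ℚ`-semialgebraic at rational `t`), fibre integrability on `(0,1)`, an ARC OF IDENTITIES meaning that
at every rational `q ∈ (0,1)` all integral representations realising the two fibres are
`KZ.Equivalent`, and `L¹`-endpoints `KZ.RawFamily.HasL1Limit`.

## Contents (all proved; axioms `propext`, `Classical.choice`, `Quot.sound`)

* `summit_of_rawArcs` — the route's `closes` seam on the re-typed halves: raw closure → raw lifting →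
  `KontsevichZagierPeriods` (hypotheses LITERALLY the registered stub signatures
  `stub_rawArcClosure`, `stub_rawArcLifting` of the line).
* `rawArcLifting_of_summit` — `KontsevichZagierPeriods →` raw lifting, by CONSTANT raw families
  (`KZ.RawFamily.const`, `hasL1Limit_const`; realisations of `(σ, f)` are congruent to `r` by
  `KZ.of_sub_of_mem_relations_of_eqOn`).
* `rawArcClosure_of_summit` — `KontsevichZagierPeriods →` raw closure: the values of the rational
  fibres agree (`KZ.Equivalent.value_eq_holds` on realisations, which exist by
  `KZ.RawFamily.isSemialgebraic_fibre` / `isSemialgebraicFunOn_fibreFun` and fibre integrability),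
  `L¹`-convergence gives convergence of the fibre values (`tendsto_integral_indicator_fibre`), the
  rational sequence `1/(k+1) → 0⁺` makes the two limits equal, and `kzPeriodConjecture'_iff_isRational`
  removes the `IsRational` restriction of the summit. This is the raw analogue of item 3157
  (`SpArcClosureOfSummit`).
* `summit_iff_rawArcs` — hence `KontsevichZagierPeriods ↔ (raw closure ∧ raw lifting)`: the re-typed
  pair is an honest (summit-equivalent as a pair, each half summit-implied) decomposition.
* `arcs_of_equivalent`, `spArcLifting_of_summit` — constant TYPED arcs: `KontsevichZagierPeriods →
  SpArcLifting`; with the route's `closes`, `summit_iff_spArcLifting_of_spArcClosure :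
  SpArcClosure → (KontsevichZagierPeriods ↔ SpArcLifting)` — the typed crux is the summit as soon as
  the typed `SpArcClosure` (item 3153, provable by arc rigidity) lands.

Not here: the two stubs themselves (`stub_rawArcClosure`, the tame-limit half, XL;
`stub_rawArcLifting`, the arithmetic half, open-problem-sized), and arc rigidity (item 3153's line).

Sources: M. Kontsevich, D. Zagier, *Periods* (2001), §1.2 Conjecture 1 [KontsevichZagier2001];
L. van den Dries, *Tame topology and o-minimal structures* (1998), Ch. 3 (3.1), Ch. 9 [Dries1998].
-/

noncomputable section

namespace Summit.KontsevichZagierPeriods.StandardParts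

open Filter Set MeasureTheory Topology
open Literature.NumberTheory.Transcendental
open Literature.ModelTheory.ExponentialFields (IsSemialgebraic)
open Summit.KontsevichZagierPeriods.KontsevichZagierPeriods.Theses.StandardParts
  (SpArcLifting SpArcClosure closes)

variable {n m : ℕ}

/-! ### Fibres of raw families: measurability, realisations, values -/

/-- Every fibre `S_t = {x | (x, t) ∈ S}` of a raw `ℚ`-semialgebraic family is Lebesgue measurable
(preimage of the Borel set `S` under the continuous map `x ↦ (x, t)`). [folklore] -/
theorem measurableSet_rawFamily_fibre (S : KZ.RawFamily n) (t : ℝ) : MeasurableSet (S.fibre t) := by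
  have hS : MeasurableSet S.total :=
    Literature.ModelTheory.ExponentialFields.IsSemialgebraic.measurableSet_holds S.isSemialgebraic_total
  have hc : Continuous fun x : Fin n → ℝ => (Fin.snoc x t : Fin (n + 1) → ℝ) :=
    Continuous.finSnoc (A := fun _ : Fin (n + 1) => ℝ) continuous_id continuous_const
  exact hc.measurable hS

/-- At a RATIONAL parameter `q`, an integrable fibre `(S_q, G_q)` of a raw family is realised by an
integral representation with exactly these data (the fibre is `ℚ`-semialgebraic by
`KZ.RawFamily.isSemialgebraic_fibre`, its integrand by `isSemialgebraicFunOn_fibreFun`).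
[cite: Dries1998, Ch. 3 (3.1)] -/
theorem exists_integralRep_rawFamily_fibre (S : KZ.RawFamily n) (q : ℚ)
    (hi : IntegrableOn (S.fibreFun q) (S.fibre q)) :
    ∃ ρ : KZ.IntegralRep n, ρ.domain = S.fibre q ∧ ρ.integrand = S.fibreFun q :=
  ⟨⟨S.fibre q, S.fibreFun q, S.isSemialgebraic_fibre q, S.isSemialgebraicFunOn_fibreFun q, hi⟩,
    rfl, rfl⟩

/-- The value of any realisation of the fibre at `t` is the integral of the extended-by-zero fibre
integrand `1_{S_t} · G_t`. [folklore] -/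
theorem value_eq_integral_indicator_fibre (S : KZ.RawFamily n) (t : ℝ) (ρ : KZ.IntegralRep n)
    (hd : ρ.domain = S.fibre t) (hf : EqOn ρ.integrand (S.fibreFun t) (S.fibre t)) :
    ρ.value = ∫ x, (S.fibre t).indicator (S.fibreFun t) x := by
  rw [KZ.IntegralRep.value, integral_indicator (measurableSet_rawFamily_fibre S t), hd]
  exact setIntegral_congr_fun (measurableSet_rawFamily_fibre S t) hf

/-- `L¹`-convergence of a raw family with integrable fibres on `(0,1)` to `r₀` gives convergence of
the fibre values `∫ 1_{S_t} G_t → r₀.value` as `t → 0⁺` (`|∫ F_t − ∫ F₀| ≤ ∫ |F_t − F₀|`; fibre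
integrability excludes the Bochner junk value). [folklore] -/
theorem tendsto_integral_indicator_fibre (S : KZ.RawFamily n) (r₀ : KZ.IntegralRep n)
    (hi : ∀ t ∈ Set.Ioo (0:ℝ) 1, IntegrableOn (S.fibreFun t) (S.fibre t))
    (h : S.HasL1Limit r₀) :
    Tendsto (fun t : ℝ => ∫ x, (S.fibre t).indicator (S.fibreFun t) x) (𝓝[>] (0:ℝ))
      (𝓝 r₀.value) := by
  rw [integralRep_value_eq_integral_indicator, tendsto_iff_norm_sub_tendsto_zero]
  refine squeeze_zero_norm' ?_ h
  filter_upwards [Ioo_mem_nhdsGT (zero_lt_one' ℝ)] with t ht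
  rw [norm_norm, Real.norm_eq_abs,
    ← integral_sub ((integrable_indicator_iff (measurableSet_rawFamily_fibre S t)).mpr (hi t ht))
      ((integrable_indicator_iff (KZ.IntegralRep.measurableSet_domain_holds _)).mpr r₀.integrableOn)]
  exact abs_integral_le_integral_abs

/-- The rational sequence `1/(k+1)` tends to `0` from the right. [folklore] -/
theorem tendsto_one_div_nat_succ_nhdsGT :
    Tendsto (fun k : ℕ => (1:ℝ) / ((k:ℝ) + 1)) atTop (𝓝[>] (0:ℝ)) :=
  tendsto_nhdsWithin_iff.2 ⟨tendsto_one_div_add_atTop_nhds_zero_nat,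
    Eventually.of_forall fun k => Set.mem_Ioi.2 (by positivity)⟩

/-! ### The glue of the line and its converses -/

/-- **The two re-typed halves decide the summit** (the route's `closes` seam, on raw arcs): lift the
equal-valued rational pair to a raw arc of identities (`h₂`), then close at the endpoints (`h₁`).
The two hypotheses are LITERALLY the registered stub signatures `stub_rawArcClosure` /
`stub_rawArcLifting` of the line `registered` on stmt-KontsevichZagierPeriods-3155 (this glue is itself
registered as the sub-goal `summit_of_rawArcs` of the skeleton).
[cite: KontsevichZagier2001, §1.2 Conjecture 1] -/
theorem summit_of_rawArcs :
    (∀ ⦃n m : ℕ⦄ (S : KZ.RawFamily n) (S' : KZ.RawFamily m)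
      (r₀ : KZ.IntegralRep n) (r₀' : KZ.IntegralRep m),
      (∀ t ∈ Set.Ioo (0:ℝ) 1, IntegrableOn (S.fibreFun t) (S.fibre t)) →
      (∀ t ∈ Set.Ioo (0:ℝ) 1, IntegrableOn (S'.fibreFun t) (S'.fibre t)) →
      (∀ q : ℚ, (q : ℝ) ∈ Set.Ioo (0:ℝ) 1 → ∀ (ρ : KZ.IntegralRep n) (ρ' : KZ.IntegralRep m),
        ρ.domain = S.fibre q → Set.EqOn ρ.integrand (S.fibreFun q) (S.fibre q) →
        ρ'.domain = S'.fibre q → Set.EqOn ρ'.integrand (S'.fibreFun q) (S'.fibre q) →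
        KZ.Equivalent ρ ρ') →
      S.HasL1Limit r₀ → S'.HasL1Limit r₀' → KZ.Equivalent r₀ r₀') →
    (∀ ⦃n m : ℕ⦄ (r : KZ.IntegralRep n) (r' : KZ.IntegralRep m),
      r.IsRational → r'.IsRational → r.value = r'.value →
      ∃ (S : KZ.RawFamily n) (S' : KZ.RawFamily m),
        (∀ t ∈ Set.Ioo (0:ℝ) 1, IntegrableOn (S.fibreFun t) (S.fibre t)) ∧
        (∀ t ∈ Set.Ioo (0:ℝ) 1, IntegrableOn (S'.fibreFun t) (S'.fibre t)) ∧
        (∀ q : ℚ, (q : ℝ) ∈ Set.Ioo (0:ℝ) 1 → ∀ (ρ : KZ.IntegralRep n) (ρ' : KZ.IntegralRep m),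
          ρ.domain = S.fibre q → Set.EqOn ρ.integrand (S.fibreFun q) (S.fibre q) →
          ρ'.domain = S'.fibre q → Set.EqOn ρ'.integrand (S'.fibreFun q) (S'.fibre q) →
          KZ.Equivalent ρ ρ') ∧
        S.HasL1Limit r ∧ S'.HasL1Limit r') →
    KontsevichZagierPeriods := by
  intro h₁ h₂ n m r r' hr hr' hv
  obtain ⟨S, S', hi, hi', heq, hl, hl'⟩ := h₂ r r' hr hr' hv
  exact h₁ S S' r r' hi hi' heq hl hl'

/-- **The summit implies raw lifting** (constant raw families). Given `r ~ r'` (which the summit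
provides for an equal-valued rational pair), the constant families `KZ.RawFamily.const r`,
`const r'` have fibres `(σ, f)`, `(σ', f')` at every parameter, integrable by `r.integrableOn`; every
realisation of `(σ, f)` is congruent to `r` (`KZ.of_sub_of_mem_relations_of_eqOn`), so the fibres form
an arc of identities; and constant families converge to themselves (`hasL1Limit_const`).
[cite: KontsevichZagier2001, §1.2 Conjecture 1] -/
theorem rawArcLifting_of_summit (hS : KontsevichZagierPeriods) :
    ∀ ⦃n m : ℕ⦄ (r : KZ.IntegralRep n) (r' : KZ.IntegralRep m),
      r.IsRational → r'.IsRational → r.value = r'.value →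
      ∃ (S : KZ.RawFamily n) (S' : KZ.RawFamily m),
        (∀ t ∈ Set.Ioo (0:ℝ) 1, IntegrableOn (S.fibreFun t) (S.fibre t)) ∧
        (∀ t ∈ Set.Ioo (0:ℝ) 1, IntegrableOn (S'.fibreFun t) (S'.fibre t)) ∧
        (∀ q : ℚ, (q : ℝ) ∈ Set.Ioo (0:ℝ) 1 → ∀ (ρ : KZ.IntegralRep n) (ρ' : KZ.IntegralRep m),
          ρ.domain = S.fibre q → Set.EqOn ρ.integrand (S.fibreFun q) (S.fibre q) →
          ρ'.domain = S'.fibre q → Set.EqOn ρ'.integrand (S'.fibreFun q) (S'.fibre q) →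
          KZ.Equivalent ρ ρ') ∧
        S.HasL1Limit r ∧ S'.HasL1Limit r' := by
  intro n m r r' hr hr' hv
  have hrr' : KZ.Equivalent r r' := hS r r' hr hr' hv
  refine ⟨KZ.RawFamily.const r, KZ.RawFamily.const r', ?_, ?_, ?_,
    KZ.RawFamily.hasL1Limit_const r, KZ.RawFamily.hasL1Limit_const r'⟩
  · intro t _
    simpa only [KZ.RawFamily.fibre_const, KZ.RawFamily.fibreFun_const] using r.integrableOn
  · intro t _
    simpa only [KZ.RawFamily.fibre_const, KZ.RawFamily.fibreFun_const] using r'.integrableOn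
  · intro q _ ρ ρ' hρd hρf hρ'd hρ'f
    simp only [KZ.RawFamily.fibre_const, KZ.RawFamily.fibreFun_const] at hρd hρf hρ'd hρ'f
    have e₁ : KZ.Equivalent ρ r :=
      KZ.of_sub_of_mem_relations_of_eqOn hρd.symm (by rw [hρd]; exact hρf)
    have e₂ : KZ.Equivalent ρ' r' :=
      KZ.of_sub_of_mem_relations_of_eqOn hρ'd.symm (by rw [hρ'd]; exact hρ'f)
    exact e₁.trans (hrr'.trans e₂.symm)

/-- **The summit implies raw closure** (the raw analogue of item 3157 `SpArcClosureOfSummit`). At a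
rational `q ∈ (0,1)` the fibres are realised by integral representations
(`exists_integralRep_rawFamily_fibre`), which are `KZ.Equivalent` by hypothesis, so the fibre values
`∫ 1_{S_q} G_q = ∫ 1_{S'_q} G'_q` agree (`KZ.Equivalent.value_eq_holds`); `L¹`-convergence gives
`∫ 1_{S_t} G_t → r₀.value`, `∫ 1_{S'_t} G'_t → r₀'.value` as `t → 0⁺`
(`tendsto_integral_indicator_fibre`); along the rational sequence `1/(k+1) → 0⁺` the two sequences
coincide, so `r₀.value = r₀'.value`, and the summit (with `kzPeriodConjecture'_iff_isRational`
removing the `IsRational` restriction) gives `r₀ ~ r₀'`. No semialgebraic geometry beyond the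
rational fibres is used: a refutation of the raw closure statement refutes Conjecture 1.
[cite: KontsevichZagier2001, §1.2 Conjecture 1] -/
theorem rawArcClosure_of_summit (hS : KontsevichZagierPeriods) :
    ∀ ⦃n m : ℕ⦄ (S : KZ.RawFamily n) (S' : KZ.RawFamily m)
      (r₀ : KZ.IntegralRep n) (r₀' : KZ.IntegralRep m),
      (∀ t ∈ Set.Ioo (0:ℝ) 1, IntegrableOn (S.fibreFun t) (S.fibre t)) →
      (∀ t ∈ Set.Ioo (0:ℝ) 1, IntegrableOn (S'.fibreFun t) (S'.fibre t)) →
      (∀ q : ℚ, (q : ℝ) ∈ Set.Ioo (0:ℝ) 1 → ∀ (ρ : KZ.IntegralRep n) (ρ' : KZ.IntegralRep m),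
        ρ.domain = S.fibre q → Set.EqOn ρ.integrand (S.fibreFun q) (S.fibre q) →
        ρ'.domain = S'.fibre q → Set.EqOn ρ'.integrand (S'.fibreFun q) (S'.fibre q) →
        KZ.Equivalent ρ ρ') →
      S.HasL1Limit r₀ → S'.HasL1Limit r₀' → KZ.Equivalent r₀ r₀' := by
  intro n m S S' r₀ r₀' hi hi' heq hl hl'
  have hP : KZPeriodConjecture' := kzPeriodConjecture'_iff_isRational.mpr hS
  apply hP
  have h₁ := (tendsto_integral_indicator_fibre S r₀ hi hl).comp tendsto_one_div_nat_succ_nhdsGT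
  have h₂ := (tendsto_integral_indicator_fibre S' r₀' hi' hl').comp tendsto_one_div_nat_succ_nhdsGT
  refine tendsto_nhds_unique (h₁.congr' ?_) h₂
  filter_upwards [eventually_ge_atTop 1] with k hk
  have hk' : (1:ℝ) ≤ k := by exact_mod_cast hk
  have hq : (((1 / ((k:ℚ) + 1) : ℚ)) : ℝ) = (1:ℝ) / ((k:ℝ) + 1) := by push_cast; ring
  have hmem : (((1 / ((k:ℚ) + 1) : ℚ)) : ℝ) ∈ Set.Ioo (0:ℝ) 1 := by
    rw [hq]
    constructor
    · positivity
    · rw [div_lt_one (by positivity)]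
      linarith
  have hiq : IntegrableOn (S.fibreFun (((1 / ((k:ℚ) + 1) : ℚ)) : ℝ))
      (S.fibre (((1 / ((k:ℚ) + 1) : ℚ)) : ℝ)) := hi _ hmem
  have hiq' : IntegrableOn (S'.fibreFun (((1 / ((k:ℚ) + 1) : ℚ)) : ℝ))
      (S'.fibre (((1 / ((k:ℚ) + 1) : ℚ)) : ℝ)) := hi' _ hmem
  obtain ⟨ρ, hρd, hρf⟩ := exists_integralRep_rawFamily_fibre S _ hiq
  obtain ⟨ρ', hρ'd, hρ'f⟩ := exists_integralRep_rawFamily_fibre S' _ hiq'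
  have hv : ρ.value = ρ'.value :=
    KZ.Equivalent.value_eq_holds
      (heq _ hmem ρ ρ' hρd (fun x _ => by rw [hρf]) hρ'd (fun x _ => by rw [hρ'f]))
  simp only [Function.comp_apply]
  rw [← hq, ← value_eq_integral_indicator_fibre S _ ρ hρd (fun x _ => by rw [hρf]),
    ← value_eq_integral_indicator_fibre S' _ ρ' hρ'd (fun x _ => by rw [hρ'f]), hv]

/-- **The re-typed pair is summit-equivalent**: `KontsevichZagierPeriods ↔ (raw closure ∧ raw
lifting)` (`rawArcClosure_of_summit`, `rawArcLifting_of_summit`, `summit_of_rawArcs`). Certifies the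
re-lining recommended by the planner and the refuters: supersede the typed items 3153 / 3155 by items
with exactly these two signatures, `closes` re-certified by `summit_of_rawArcs`.
[cite: KontsevichZagier2001, §1.2 Conjecture 1] -/
theorem summit_iff_rawArcs :
    KontsevichZagierPeriods ↔
      ((∀ ⦃n m : ℕ⦄ (S : KZ.RawFamily n) (S' : KZ.RawFamily m)
        (r₀ : KZ.IntegralRep n) (r₀' : KZ.IntegralRep m),
        (∀ t ∈ Set.Ioo (0:ℝ) 1, IntegrableOn (S.fibreFun t) (S.fibre t)) →
        (∀ t ∈ Set.Ioo (0:ℝ) 1, IntegrableOn (S'.fibreFun t) (S'.fibre t)) →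
        (∀ q : ℚ, (q : ℝ) ∈ Set.Ioo (0:ℝ) 1 → ∀ (ρ : KZ.IntegralRep n) (ρ' : KZ.IntegralRep m),
          ρ.domain = S.fibre q → Set.EqOn ρ.integrand (S.fibreFun q) (S.fibre q) →
          ρ'.domain = S'.fibre q → Set.EqOn ρ'.integrand (S'.fibreFun q) (S'.fibre q) →
          KZ.Equivalent ρ ρ') →
        S.HasL1Limit r₀ → S'.HasL1Limit r₀' → KZ.Equivalent r₀ r₀') ∧
      (∀ ⦃n m : ℕ⦄ (r : KZ.IntegralRep n) (r' : KZ.IntegralRep m),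
        r.IsRational → r'.IsRational → r.value = r'.value →
        ∃ (S : KZ.RawFamily n) (S' : KZ.RawFamily m),
          (∀ t ∈ Set.Ioo (0:ℝ) 1, IntegrableOn (S.fibreFun t) (S.fibre t)) ∧
          (∀ t ∈ Set.Ioo (0:ℝ) 1, IntegrableOn (S'.fibreFun t) (S'.fibre t)) ∧
          (∀ q : ℚ, (q : ℝ) ∈ Set.Ioo (0:ℝ) 1 → ∀ (ρ : KZ.IntegralRep n) (ρ' : KZ.IntegralRep m),
            ρ.domain = S.fibre q → Set.EqOn ρ.integrand (S.fibreFun q) (S.fibre q) →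
            ρ'.domain = S'.fibre q → Set.EqOn ρ'.integrand (S'.fibreFun q) (S'.fibre q) →
            KZ.Equivalent ρ ρ') ∧
          S.HasL1Limit r ∧ S'.HasL1Limit r')) :=
  ⟨fun hS => ⟨rawArcClosure_of_summit hS, rawArcLifting_of_summit hS⟩,
    fun h => summit_of_rawArcs h.1 h.2⟩

/-! ### Constant typed arcs: the summit implies the typed crux -/

/-- **Constant arcs.** A `KZ.Equivalent` pair `(r, r')` is the pair of `L¹`-endpoints of typed arcs of
identities in the sense of the crux `SpArcLifting`: take `R t = r`, `R' t = r'`; the total domain over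
`(0,1)` is the cylinder `σ × (0,1)` and the total integrand is `f ∘ Fin.init`, both `ℚ`-semialgebraic
(`KZ.IntegralRep.isSemialgebraicFamilyOn_const` and the total-space lemmas of `KZMoveFamily.lean` —
`KZ.totalSet (Ioo 0 1) _` is definitionally the crux's total domain —,
`KZ.BallPeeling.isSemialgebraic_posIoo`); fibrewise equivalence is `r ∼ r'`; the `L¹`-distances are
identically `0`. [cite: KontsevichZagier2001, §1.2] -/
theorem arcs_of_equivalent (r : KZ.IntegralRep n) (r' : KZ.IntegralRep m)
    (hrr' : KZ.Equivalent r r') :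
    ∃ (R : ℝ → KZ.IntegralRep n) (R' : ℝ → KZ.IntegralRep m),
      IsSemialgebraic ℚ {z : Fin (n + 1) → ℝ | z (Fin.last n) ∈ Set.Ioo (0:ℝ) 1 ∧
        Fin.init z ∈ (R (z (Fin.last n))).domain} ∧
      IsSemialgebraicFunOn ℚ {z : Fin (n + 1) → ℝ | z (Fin.last n) ∈ Set.Ioo (0:ℝ) 1 ∧
        Fin.init z ∈ (R (z (Fin.last n))).domain} (fun z => (R (z (Fin.last n))).integrand (Fin.init z)) ∧
      IsSemialgebraic ℚ {z : Fin (m + 1) → ℝ | z (Fin.last m) ∈ Set.Ioo (0:ℝ) 1 ∧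
        Fin.init z ∈ (R' (z (Fin.last m))).domain} ∧
      IsSemialgebraicFunOn ℚ {z : Fin (m + 1) → ℝ | z (Fin.last m) ∈ Set.Ioo (0:ℝ) 1 ∧
        Fin.init z ∈ (R' (z (Fin.last m))).domain} (fun z => (R' (z (Fin.last m))).integrand (Fin.init z)) ∧
      (∀ t ∈ Set.Ioo (0:ℝ) 1, KZ.Equivalent (R t) (R' t)) ∧
      Tendsto (fun t : ℝ => ∫ x, |(R t).domain.indicator (R t).integrand x -
        r.domain.indicator r.integrand x|) (𝓝[>] (0:ℝ)) (𝓝 0) ∧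
      Tendsto (fun t : ℝ => ∫ x, |(R' t).domain.indicator (R' t).integrand x -
        r'.domain.indicator r'.integrand x|) (𝓝[>] (0:ℝ)) (𝓝 0) := by
  have hT : IsSemialgebraic ℚ {x : Fin 1 → ℝ | x 0 ∈ Set.Ioo (0:ℝ) 1} :=
    KZ.BallPeeling.isSemialgebraic_posIoo
  have hR := KZ.IntegralRep.isSemialgebraicFamilyOn_const (Set.Ioo (0:ℝ) 1) r
  have hR' := KZ.IntegralRep.isSemialgebraicFamilyOn_const (Set.Ioo (0:ℝ) 1) r'
  refine ⟨fun _ => r, fun _ => r', hR.isSemialgebraic_totalSet hT, hR.isSemialgebraicFunOn_totalFun hT,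
    hR'.isSemialgebraic_totalSet hT, hR'.isSemialgebraicFunOn_totalFun hT, fun t _ => hrr', ?_, ?_⟩
  · simp only [sub_self, abs_zero, integral_zero]
    exact tendsto_const_nhds
  · simp only [sub_self, abs_zero, integral_zero]
    exact tendsto_const_nhds

/-- **The summit implies the typed crux** `SpArcLifting` (constant arcs, `arcs_of_equivalent`): the
elementary half of the summit-equivalence of the typed crux. [cite: KontsevichZagier2001, §1.2 Conjecture 1] -/
theorem spArcLifting_of_summit : KontsevichZagierPeriods → SpArcLifting := by
  intro hS n m r r' hr hr' hv
  exact arcs_of_equivalent r r' (hS r r' hr hr' hv)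

/-- **Given the typed closure half, the typed lifting half IS the summit**:
`SpArcClosure → (KontsevichZagierPeriods ↔ SpArcLifting)` — forward by constant arcs
(`spArcLifting_of_summit`), backward by the route's own deciding theorem `closes`. Since the typed
`SpArcClosure` (item 3153) is provable outright by arc rigidity (eventual constancy of
`IntegralRep`-valued `ℚ`-semialgebraic arcs), this records that item 3155 as typed carries exactly
Conjecture 1. [cite: KontsevichZagier2001, §1.2 Conjecture 1] -/
theorem summit_iff_spArcLifting_of_spArcClosure (h₁ : SpArcClosure) :
    KontsevichZagierPeriods ↔ SpArcLifting :=
  ⟨spArcLifting_of_summit, closes h₁⟩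

end Summit.KontsevichZagierPeriods.StandardParts
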